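import Summits.AtomisticToContinuum.Crystallization.Theses.LuttingerTiszaRegistry
import Summits.AtomisticToContinuum.Crystallization.Theses.LaminarSixThreeThree
import Summits.AtomisticToContinuum.Crystallization.Theses.PoissonBesselStacking
import Summits.AtomisticToContinuum.Crystallization.Theses.ThreeConeCertificate
import Summits.AtomisticToContinuum.Crystallization.Theses.FrustrationRangeCertificates
import Summits.AtomisticToContinuum.Crystallization.Theses.CrystalKissingRigidity
import Summits.AtomisticToContinuum.Crystallization.Theorems.ThreeConeCertificateKeplerBoundBulkTails
import Summits.AtomisticToContinuum.Crystallization.Theorems.ChargedEnergyGap.Negative.Unconditional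

/-!
# Crux `BulkDefectVanish` (stmt-AtomisticToContinuum-0751) — line `param-lock` (crux-strategist, route LuttingerTiszaRegistry)

Registered skeleton of the strategist's DECOMPOSITION of the positional hinge (BC2 redirect of the RESTATED
deciding crux; re-audit 2026-08-17).  Four named stubs (rev 4: the accounting stub of rev 1–3 is now PROVED, §6b) and a kernel-checked composition
`BulkDefectVanish_of` concluding `LuttingerTiszaRegistry.BulkDefectVanish` BY NAME (copies for the shared decls
of `PoissonBesselStacking` / `ThreeConeCertificate` / `FrustrationRangeCertificates` / `CrystalKissingRigidity`):

* `stub_laminarBarlowWindows` = item 14292 verbatim (LAYERING, shared open physics);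
* `stub_stackingFaultSparsity` = item 14296 verbatim (STACKING SELECTION; in this route fed by the counted
  fault price of `LjFaultCountedSelection`);
* `stub_hcpEnergyCoercive` (NEW, numerics-grade): the relaxed-hcp Lennard-Jones energy per particle
  `(a, h) ↦ e(hcp a h)` is `κ`-coercive on the box `(1/2, 2)²` about ONE minimiser `(a₀, h₀)`;
* `stub_hcpMatchedSiteEnergy` (NEW, analysis, M): a particle of a ground state based-hcp-matched at a fine
  enough scale with parameters `(a, h)` has site energy `≥ 2 e(hcp a h) − η` (truncation of the lattice sum,
  modulus of continuity of `V_LJ` above the ground-state hard core, far tail; cf. the landed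
  `KeplerBoundBulk.siteEnergy_ge_of_matchedAt`);
* `parameterLockAccounting` (PROVED, §6b; formerly stub 5): coercivity + matched site energies +
  (hypothesis) a.e. particle hcp-matched at every scale ⇒ for every `(R, ε, δ)` the particles matched only
  at parameters `δ`-off `(a₀, h₀)` have vanishing density (three-class energy accounting
  `#strained · 2κδ² ≤ ηN + #unmatched · C` against `2E(N) ≤ N(2e₀ + η)` eventually — `crysEnergyLimit`,
  `eStar_le`, hard-core floor `siteEnergy_lennardJones_ge` — with `η = κδ²t/4`, matching monotone in the scale).

Stubs 3–4 and the proved accounting compose (`HcpParameterLock_of`) to the NEW PIECE `HcpParameterLock`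
(lattice-parameter lock at ONE `(a₀, h₀)`; no template, no un-based window), and the PROVED glue
`bulkDefectVanish_of_pieces : LaminarBarlowWindows → StackingFaultSparsity → HcpParameterLock → BulkDefectVanish`
(§1–§6 below, identical to `Cruxes/BulkDefectVanish/SplitGlue.lean` @0fb8a50bd81f: UN-BASING of hcp — the
hinge's vertex-transitivity worry discharged by proof —, PARAMETER TRANSFER, scale bookkeeping, union bounds)
gives the crux.  `sorry` occurs ONLY inside the four `stub_*`.

Differs from line `birth` (planner-skel, 2026-08-17): there stub 3 `HcpTemplateLock` contains the crux predicate
(un-based `P`-window) verbatim and the composition is a pure union bound; here the un-basing and the parameter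
transfer are PROVED, and the open third piece is the parameter lock alone, cut into numerics
(`stub_hcpEnergyCoercive`) and ONE analysis stub (`stub_hcpMatchedSiteEnergy`), the accounting being proved.

Disproof used: none on file for 0751 (`ledger crux ls`: no Disproof.lean, no Negative lemmas). Negatives of the
sub-problem (4146, 15929, 3506, 17253) are finite-configuration statements; none is an instance of a stub here.
-/

noncomputable section

open scoped BigOperators Topology
open Filter Metric
open Literature.MathematicalPhysics.StatisticalMechanics

namespace Summit.AtomisticToContinuum.Crystallization.Cruxes.BulkDefectVanish.ParamLock

local notation "E3" => EuclideanSpace ℝ (Fin 3)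

/-! ## §1 Counting glue -/

/-- Union bound: a particle that is not `G`-good is either not `B`-good, or `B`-good and not
`G`-good. [folklore] -/
theorem natCard_not_le_add {N : ℕ} (B G : Fin N → Prop) :
    Nat.card {i : Fin N // ¬ G i} ≤
      Nat.card {i : Fin N // ¬ B i} + Nat.card {i : Fin N // B i ∧ ¬ G i} := by
  calc Nat.card {i : Fin N // ¬ G i} = ({i | ¬ G i} : Set (Fin N)).ncard := rfl
    _ ≤ ({i | ¬ B i} ∪ {i | B i ∧ ¬ G i} : Set (Fin N)).ncard := by
        refine Set.ncard_le_ncard (fun i hi => ?_)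
        simp only [Set.mem_setOf_eq, Set.mem_union] at hi ⊢
        by_cases hB : B i
        · exact Or.inr ⟨hB, hi⟩
        · exact Or.inl hB
    _ ≤ ({i | ¬ B i} : Set (Fin N)).ncard + ({i | B i ∧ ¬ G i} : Set (Fin N)).ncard :=
        Set.ncard_union_le _ _
    _ = Nat.card {i : Fin N // ¬ B i} + Nat.card {i : Fin N // B i ∧ ¬ G i} := rfl

/-- Two-stage density bound: if the density of non-`B` particles and the density of
`B`-but-not-`G` particles both tend to `0`, so does the density of non-`G` particles. [folklore] -/
theorem tendsto_density_two_stage (B G : (N : ℕ) → Fin N → Prop)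
    (hB : Tendsto (fun N : ℕ => (Nat.card {i : Fin N // ¬ B N i} : ℝ) / N) atTop (nhds 0))
    (hBG : Tendsto (fun N : ℕ => (Nat.card {i : Fin N // B N i ∧ ¬ G N i} : ℝ) / N)
      atTop (nhds 0)) :
    Tendsto (fun N : ℕ => (Nat.card {i : Fin N // ¬ G N i} : ℝ) / N) atTop (nhds 0) := by
  have hsum : Tendsto (fun N : ℕ => (Nat.card {i : Fin N // ¬ B N i} : ℝ) / N +
      (Nat.card {i : Fin N // B N i ∧ ¬ G N i} : ℝ) / N) atTop (nhds 0) := by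
    simpa only [add_zero] using hB.add hBG
  refine squeeze_zero (fun N => by positivity) (fun N => ?_) hsum
  rw [← add_div]
  gcongr
  exact_mod_cast natCard_not_le_add (B N) (G N)

/-- Monotone comparison of densities: if every `B`-good particle is `G`-good and the non-`B`
particles have vanishing density, so do the non-`G` particles. [folklore] -/
theorem tendsto_density_mono (B G : (N : ℕ) → Fin N → Prop) (hBG : ∀ N i, B N i → G N i)
    (hB : Tendsto (fun N : ℕ => (Nat.card {i : Fin N // ¬ B N i} : ℝ) / N) atTop (nhds 0)) :
    Tendsto (fun N : ℕ => (Nat.card {i : Fin N // ¬ G N i} : ℝ) / N) atTop (nhds 0) := by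
  refine squeeze_zero (fun N => by positivity) (fun N => ?_) hB
  gcongr
  have : Nat.card {i : Fin N // ¬ G N i} ≤ Nat.card {i : Fin N // ¬ B N i} :=
    calc Nat.card {i : Fin N // ¬ G N i} = ({i | ¬ G N i} : Set (Fin N)).ncard := rfl
      _ ≤ ({i | ¬ B N i} : Set (Fin N)).ncard := by
          refine Set.ncard_le_ncard (fun i hi => ?_)
          simp only [Set.mem_setOf_eq] at hi ⊢
          exact fun hb => hi (hBG N i hb)
      _ = Nat.card {i : Fin N // ¬ B N i} := rfl
  exact_mod_cast this

/-! ## §2 Un-basing: the hcp stacking seen from any of its sites -/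

section Unbase

variable (a h : ℝ)

/-- Layer labels of hcp: `0` on even layers. [folklore] -/
theorem haggLabel_alternating_of_even {k : ℤ} (hk : Even k) : haggLabel alternatingHagg k = 0 := by
  rw [haggLabel_alternating, if_pos hk]

/-- Layer labels of hcp: `1` on odd layers. [folklore] -/
theorem haggLabel_alternating_of_odd {k : ℤ} (hk : Odd k) : haggLabel alternatingHagg k = 1 := by
  rw [haggLabel_alternating, if_neg (Int.not_even_iff_odd.2 hk)]

/-- Translating hcp by a site of an EVEN layer maps sites to sites:
`barlowPos k₀ i₀ j₀ + barlowPos k i j = barlowPos (k₀ + k) (i₀ + i) (j₀ + j)`. [folklore] -/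
theorem hcp_add_of_even {k₀ : ℤ} (hk₀ : Even k₀) (i₀ j₀ k i j : ℤ) :
    barlowPos a h alternatingHagg k₀ i₀ j₀ + barlowPos a h alternatingHagg k i j =
      barlowPos a h alternatingHagg (k₀ + k) (i₀ + i) (j₀ + j) := by
  have hL0 : haggLabel alternatingHagg k₀ = 0 := haggLabel_alternating_of_even hk₀
  have hL : haggLabel alternatingHagg (k₀ + k) = haggLabel alternatingHagg k := by
    rcases Int.even_or_odd k with hk | hk
    · rw [haggLabel_alternating_of_even hk, haggLabel_alternating_of_even (hk₀.add hk)]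
    · rw [haggLabel_alternating_of_odd hk, haggLabel_alternating_of_odd (hk₀.add_odd hk)]
  ext l
  fin_cases l <;> simp [hL0, hL] <;> ring

/-- … and conversely `barlowPos k i j − barlowPos k₀ i₀ j₀ = barlowPos (k − k₀) (i − i₀) (j − j₀)` for
even `k₀`. [folklore] -/
theorem hcp_sub_of_even {k₀ : ℤ} (hk₀ : Even k₀) (i₀ j₀ k i j : ℤ) :
    barlowPos a h alternatingHagg k i j - barlowPos a h alternatingHagg k₀ i₀ j₀ =
      barlowPos a h alternatingHagg (k - k₀) (i - i₀) (j - j₀) := by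
  have hL0 : haggLabel alternatingHagg k₀ = 0 := haggLabel_alternating_of_even hk₀
  have hL : haggLabel alternatingHagg (k - k₀) = haggLabel alternatingHagg k := by
    rcases Int.even_or_odd k with hk | hk
    · rw [haggLabel_alternating_of_even hk, haggLabel_alternating_of_even (hk.sub hk₀)]
    · rw [haggLabel_alternating_of_odd hk, haggLabel_alternating_of_odd (hk.sub_even hk₀)]
  ext l
  fin_cases l <;> simp [hL0, hL] <;> ring

/-- Point inversion through a site of an ODD layer maps sites to sites:
`barlowPos k₀ i₀ j₀ − barlowPos k i j = barlowPos (k₀ − k) (i₀ − i) (j₀ − j)` (the label of layer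
`k₀ − k` is `1 −` the label of layer `k`). [folklore] -/
theorem hcp_sub_of_odd {k₀ : ℤ} (hk₀ : Odd k₀) (i₀ j₀ k i j : ℤ) :
    barlowPos a h alternatingHagg k₀ i₀ j₀ - barlowPos a h alternatingHagg k i j =
      barlowPos a h alternatingHagg (k₀ - k) (i₀ - i) (j₀ - j) := by
  have hL1 : haggLabel alternatingHagg k₀ = 1 := haggLabel_alternating_of_odd hk₀
  rcases Int.even_or_odd k with hk | hk
  · have hLk : haggLabel alternatingHagg k = 0 := haggLabel_alternating_of_even hk
    have hL : haggLabel alternatingHagg (k₀ - k) = 1 :=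
      haggLabel_alternating_of_odd (hk₀.sub_even hk)
    ext l
    fin_cases l <;> simp [hL1, hLk, hL] <;> ring
  · have hLk : haggLabel alternatingHagg k = 1 := haggLabel_alternating_of_odd hk
    have hL : haggLabel alternatingHagg (k₀ - k) = 0 :=
      haggLabel_alternating_of_even (hk₀.sub_odd hk)
    ext l
    fin_cases l <;> simp [hL1, hLk, hL] <;> ring

variable {a h}

/-- **Un-basing.** For every site `z` of `hcpStacking a h` there is a linear isometry `S` with
`S ∘ S = id` (namely `S = id` for `z` in an even layer, `S = −id` for `z` in an odd layer) such that
`q ↦ z + S q` maps `hcpStacking a h` onto itself: hcp is vertex-transitive under translations composed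
with the point inversion. [folklore] -/
theorem hcp_unbase {z : E3} (hz : z ∈ hcpStacking a h) :
    ∃ S : E3 →ₗᵢ[ℝ] E3, (∀ q, S (S q) = q) ∧
      ∀ q, q ∈ hcpStacking a h ↔ z + S q ∈ hcpStacking a h := by
  obtain ⟨k₀, i₀, j₀, rfl⟩ := hz
  rcases Int.even_or_odd k₀ with hk | hk
  · refine ⟨LinearIsometry.id, fun q => by simp, fun q => ⟨?_, ?_⟩⟩
    · rintro ⟨k, i, j, rfl⟩
      exact ⟨k₀ + k, i₀ + i, j₀ + j, by simp [hcp_add_of_even a h hk]⟩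
    · rintro ⟨k, i, j, hk'⟩
      refine ⟨k - k₀, i - i₀, j - j₀, ?_⟩
      have hq : q = barlowPos a h alternatingHagg k i j - barlowPos a h alternatingHagg k₀ i₀ j₀ := by
        rw [← hk']; simp
      rw [hq, hcp_sub_of_even a h hk]
  · refine ⟨(LinearIsometryEquiv.neg ℝ).toLinearIsometry, fun q => by simp, fun q => ⟨?_, ?_⟩⟩
    · rintro ⟨k, i, j, rfl⟩
      refine ⟨k₀ - k, i₀ - i, j₀ - j, ?_⟩
      simp [← sub_eq_add_neg, hcp_sub_of_odd a h hk]
    · rintro ⟨k, i, j, hk'⟩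
      refine ⟨k₀ - k, i₀ - i, j₀ - j, ?_⟩
      have hq : q = barlowPos a h alternatingHagg k₀ i₀ j₀ - barlowPos a h alternatingHagg k i j := by
        rw [← hk']; simp
      rw [hq, hcp_sub_of_odd a h hk]

end Unbase

/-! ## §3 Parameter transfer -/

/-- **Parameter transfer.** For `a, h > 1/2` and `|a' − a|, |h' − h| ≤ δ`, moving the lattice
parameters moves the site `(k, i, j)` by at most `2δ` times its norm (the horizontal coordinates of
`barlowPos` are `a`-homogeneous, the vertical one `h`-homogeneous). [folklore] -/
theorem dist_barlowPos_param_le {a h a' h' δ : ℝ} (s : ℤ → ℤ) (ha : 1 / 2 < a) (hh : 1 / 2 < h)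
    (hδa : |a' - a| ≤ δ) (hδh : |h' - h| ≤ δ) (k i j : ℤ) :
    dist (barlowPos a' h' s k i j) (barlowPos a h s k i j) ≤ 2 * δ * ‖barlowPos a h s k i j‖ := by
  have hδ : 0 ≤ δ := (abs_nonneg _).trans hδa
  -- the `a`-homogeneous (horizontal) quadratic form of the site
  have hX0 : 0 ≤ ((i : ℝ) + (j : ℝ) / 2 + (haggLabel s k : ℝ) / 2) ^ 2 +
      (√3 / 2 * ((j : ℝ) + (haggLabel s k : ℝ) / 3)) ^ 2 := by positivity
  have hd2 : dist (barlowPos a' h' s k i j) (barlowPos a h s k i j) ^ 2 =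
      (a' - a) ^ 2 * (((i : ℝ) + (j : ℝ) / 2 + (haggLabel s k : ℝ) / 2) ^ 2 +
        (√3 / 2 * ((j : ℝ) + (haggLabel s k : ℝ) / 3)) ^ 2) + (h' - h) ^ 2 * (k : ℝ) ^ 2 := by
    rw [EuclideanSpace.dist_sq_eq, Fin.sum_univ_three, Real.dist_eq, Real.dist_eq, Real.dist_eq,
      sq_abs, sq_abs, sq_abs, barlowPos_apply_zero, barlowPos_apply_zero, barlowPos_apply_one,
      barlowPos_apply_one, barlowPos_apply_two, barlowPos_apply_two]
    ring
  have hn2 : ‖barlowPos a h s k i j‖ ^ 2 =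
      a ^ 2 * (((i : ℝ) + (j : ℝ) / 2 + (haggLabel s k : ℝ) / 2) ^ 2 +
        (√3 / 2 * ((j : ℝ) + (haggLabel s k : ℝ) / 3)) ^ 2) + h ^ 2 * (k : ℝ) ^ 2 := by
    rw [EuclideanSpace.real_norm_sq_eq, Fin.sum_univ_three, barlowPos_apply_zero,
      barlowPos_apply_one, barlowPos_apply_two]
    ring
  have h1 : (a' - a) ^ 2 ≤ (2 * δ * a) ^ 2 := by
    have hle : |a' - a| ≤ 2 * δ * a := hδa.trans (by nlinarith)
    exact sq_le_sq' (abs_le.1 hle).1 (abs_le.1 hle).2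
  have h2 : (h' - h) ^ 2 ≤ (2 * δ * h) ^ 2 := by
    have hle : |h' - h| ≤ 2 * δ * h := hδh.trans (by nlinarith)
    exact sq_le_sq' (abs_le.1 hle).1 (abs_le.1 hle).2
  have hsq : dist (barlowPos a' h' s k i j) (barlowPos a h s k i j) ^ 2 ≤
      (2 * δ * ‖barlowPos a h s k i j‖) ^ 2 :=
    calc dist (barlowPos a' h' s k i j) (barlowPos a h s k i j) ^ 2
        = (a' - a) ^ 2 * (((i : ℝ) + (j : ℝ) / 2 + (haggLabel s k : ℝ) / 2) ^ 2 +
          (√3 / 2 * ((j : ℝ) + (haggLabel s k : ℝ) / 3)) ^ 2) + (h' - h) ^ 2 * (k : ℝ) ^ 2 := hd2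
      _ ≤ (2 * δ * a) ^ 2 * (((i : ℝ) + (j : ℝ) / 2 + (haggLabel s k : ℝ) / 2) ^ 2 +
          (√3 / 2 * ((j : ℝ) + (haggLabel s k : ℝ) / 3)) ^ 2) + (2 * δ * h) ^ 2 * (k : ℝ) ^ 2 := by
          gcongr
      _ = (2 * δ) ^ 2 * (a ^ 2 * (((i : ℝ) + (j : ℝ) / 2 + (haggLabel s k : ℝ) / 2) ^ 2 +
          (√3 / 2 * ((j : ℝ) + (haggLabel s k : ℝ) / 3)) ^ 2) + h ^ 2 * (k : ℝ) ^ 2) := by ring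
      _ = (2 * δ * ‖barlowPos a h s k i j‖) ^ 2 := by rw [← hn2]; ring
  exact (pow_le_pow_iff_left₀ dist_nonneg (by positivity) two_ne_zero).1 hsq

/-- Set form of the parameter transfer: every site of `hcpStacking a h` has a site of
`hcpStacking a' h'` within `2δ` times its norm. [folklore] -/
theorem exists_hcp_near {a h a' h' δ : ℝ} (ha : 1 / 2 < a) (hh : 1 / 2 < h)
    (hδa : |a' - a| ≤ δ) (hδh : |h' - h| ≤ δ) {q : E3} (hq : q ∈ hcpStacking a h) :
    ∃ q' ∈ hcpStacking a' h', dist q' q ≤ 2 * δ * ‖q‖ := by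
  obtain ⟨k, i, j, rfl⟩ := hq
  exact ⟨_, ⟨k, i, j, rfl⟩, dist_barlowPos_param_le alternatingHagg ha hh hδa hδh k i j⟩

/-! ## §4 The matching predicates -/

/-- Particle `i` of the finite configuration `y` is BASED-hcp-matched at scale `(R, ε)` with
parameters `(a, h)`: some site `z` and linear isometry `A` two-way `ε`-match the particles within `R`
of `y i` with `y i + A (hcpStacking a h − z)` (the predicate of items 14296 / 14299). -/
def HcpBased (a h R ε : ℝ) {N : ℕ} (y : Fin N → E3) (i : Fin N) : Prop :=
  ∃ z ∈ hcpStacking a h, ∃ A : E3 →ₗᵢ[ℝ] E3,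
    (∀ p ∈ hcpStacking a h, dist p z ≤ R → ∃ j : Fin N, dist (y j) (y i + A (p - z)) ≤ ε) ∧
    (∀ j : Fin N, dist (y j) (y i) ≤ R → ∃ p ∈ hcpStacking a h, dist (y j) (y i + A (p - z)) ≤ ε)

/-- Particle `i` is UN-BASED template-matched at scale `(R, ε)` to the point set `T` (the predicate of
the hinge, with `T = P.points`). -/
def Template (T : Set E3) (R ε : ℝ) {N : ℕ} (y : Fin N → E3) (i : Fin N) : Prop :=
  ∃ A : E3 →ₗᵢ[ℝ] E3, (∀ q ∈ T, ‖q‖ ≤ R → ∃ j : Fin N, dist (y j) (y i + A q) ≤ ε) ∧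
    (∀ j : Fin N, dist (y j) (y i) ≤ R → ∃ q ∈ T, dist (y j) (y i + A q) ≤ ε)

/-! ## §5 The geometric core: a based `δ`-close hcp chart is an un-based template chart -/

/-- **Core.** If particle `i` is based-hcp-matched at `(R', ε')` with parameters `(a, h)` within `δ`
of `(a₀, h₀)` (all four parameters `> 1/2`, `δ ≤ 1/2`), then it is un-based template-matched to
`hcpStacking a₀ h₀` at every scale `(R, ε)` with `2R ≤ R'`, `ε' + 2δR ≤ ε` and
`ε' + 2δ(R + ε') ≤ ε`.  Proof: un-base the chart at `z` by `S = ±id` (`hcp_unbase`), compose the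
isometry with `S`, and move each matched site from parameters `(a, h)` to `(a₀, h₀)` at cost
`≤ 2δ ×` its norm (`exists_hcp_near`). [folklore] -/
theorem template_of_hcpBased {a h a₀ h₀ δ R R' ε ε' : ℝ}
    (ha : 1 / 2 < a) (hh : 1 / 2 < h) (ha₀ : 1 / 2 < a₀) (hh₀ : 1 / 2 < h₀)
    (hda : |a - a₀| ≤ δ) (hdh : |h - h₀| ≤ δ) (hδ2 : δ ≤ 1 / 2)
    (hR : 0 ≤ R) (hR' : 2 * R ≤ R')
    (hεf : ε' + 2 * δ * R ≤ ε) (hεc : ε' + 2 * δ * (R + ε') ≤ ε)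
    {N : ℕ} {y : Fin N → E3} {i : Fin N} (hM : HcpBased a h R' ε' y i) :
    Template (hcpStacking a₀ h₀) R ε y i := by
  obtain ⟨z, hz, A, hfwd, hconv⟩ := hM
  obtain ⟨S, hSS, hS⟩ := hcp_unbase hz
  have hδ : 0 ≤ δ := (abs_nonneg _).trans hda
  have hda' : |a₀ - a| ≤ δ := by rwa [abs_sub_comm] at hda
  have hdh' : |h₀ - h| ≤ δ := by rwa [abs_sub_comm] at hdh
  refine ⟨A.comp S, ?_, ?_⟩
  · -- forward: every template site within `R` of the origin has a particle nearby
    intro q₀ hq₀ hq₀R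
    obtain ⟨q, hq, hqq₀⟩ := exists_hcp_near ha₀ hh₀ hda hdh hq₀
    -- `q ∈ hcpStacking a h`, `dist q q₀ ≤ 2δ‖q₀‖ ≤ 2δR`
    have hqq₀' : dist q q₀ ≤ 2 * δ * R := hqq₀.trans (by gcongr)
    have hp : z + S q ∈ hcpStacking a h := (hS q).1 hq
    have hqn : ‖q‖ ≤ R' := by
      have h1 : ‖q‖ ≤ ‖q₀‖ + dist q q₀ := by
        rw [dist_eq_norm]; exact norm_le_insert' q q₀
      have h2 : 2 * δ * R ≤ R := by nlinarith
      linarith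
    have hdist : dist (z + S q) z ≤ R' := by
      rw [dist_eq_norm, add_sub_cancel_left, S.norm_map]; exact hqn
    obtain ⟨j, hj⟩ := hfwd (z + S q) hp hdist
    refine ⟨j, ?_⟩
    have key : dist (y i + A (z + S q - z)) (y i + A.comp S q₀) = dist q q₀ := by
      rw [add_sub_cancel_left]
      change dist (y i + A (S q)) (y i + A (S q₀)) = dist q q₀
      rw [dist_add_left, A.dist_map, S.dist_map]
    calc dist (y j) (y i + A.comp S q₀)
        ≤ dist (y j) (y i + A (z + S q - z)) + dist (y i + A (z + S q - z)) (y i + A.comp S q₀) :=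
          dist_triangle _ _ _
      _ ≤ ε' + 2 * δ * R := by rw [key]; exact add_le_add hj hqq₀'
      _ ≤ ε := hεf
  · -- converse: every particle within `R` of `y i` sits near a template site
    intro j hj
    have hRR' : R ≤ R' := by linarith
    obtain ⟨p, hp, hpj⟩ := hconv j (hj.trans hRR')
    obtain ⟨q, hSq, hqn0⟩ : ∃ q : E3, S q = p - z ∧ ‖q‖ = ‖p - z‖ :=
      ⟨S (p - z), hSS _, S.norm_map _⟩
    have hqmem : q ∈ hcpStacking a h := (hS q).2 (by rw [hSq, add_sub_cancel]; exact hp)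
    obtain ⟨q₀, hq₀, hq₀q⟩ := exists_hcp_near ha hh hda' hdh' hqmem
    have hqn : ‖q‖ ≤ R + ε' := by
      have h1 : ‖p - z‖ = dist (y i + A (p - z)) (y i) := by
        rw [dist_eq_norm, add_sub_cancel_left, A.norm_map]
      have h2 : dist (y i + A (p - z)) (y i) ≤ dist (y i + A (p - z)) (y j) + dist (y j) (y i) :=
        dist_triangle _ _ _
      rw [dist_comm (y i + A (p - z)) (y j)] at h2
      linarith
    have hq₀q' : dist q₀ q ≤ 2 * δ * (R + ε') := hq₀q.trans (by gcongr)
    refine ⟨q₀, hq₀, ?_⟩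
    have key : dist (y i + A (p - z)) (y i + A.comp S q₀) = dist q₀ q := by
      change dist (y i + A (p - z)) (y i + A (S q₀)) = dist q₀ q
      rw [dist_add_left, A.dist_map, ← hSq, S.dist_map, dist_comm]
    calc dist (y j) (y i + A.comp S q₀)
        ≤ dist (y j) (y i + A (p - z)) + dist (y i + A (p - z)) (y i + A.comp S q₀) :=
          dist_triangle _ _ _
      _ ≤ ε' + 2 * δ * (R + ε') := by rw [key]; exact add_le_add hpj hq₀q'
      _ ≤ ε := hεc

/-! ## §6 The new piece and the assembly -/

/-- **`X₃` — hcp LATTICE-PARAMETER LOCK** (the new crux of the split; inlined verbatim as the route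
item `LuttingerTiszaRegistry.HcpParameterLock`).  There is ONE pair `(a₀, h₀) ∈ (1/2, 2)²` such that,
along every sequence of Lennard-Jones ground states in which, at every scale `(R, ε)` (`ε < 1/4`), all
but `o(N)` particles are based-hcp-matched for some `(a, h) ∈ (1/2, 2)²`, the following holds for
all `R > 0`, `ε ∈ (0, 1/4)`, `δ > 0`: the particles that are based-hcp-matched at `(R, ε)` for some
`(a, h)` in the box but for no `(a, h)` in the box with `|a − a₀| ≤ δ`, `|h − h₀| ≤ δ` number `o(N)`.
Intended witness: the minimiser `(a₀, h₀) ≈ (0.971, 0.793)` of the relaxed-hcp Lennard-Jones energy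
per particle; mechanism: strict (quadratic) minimality of `(a, h) ↦ e(hcp a h)` plus the `O(N^{2/3})`
energy excess of ground states, the `o(N)` unmatched particles costing `O(1)` each. -/
def HcpParameterLock : Prop :=
  ∃ a₀ h₀ : ℝ, 1 / 2 < a₀ ∧ a₀ < 2 ∧ 1 / 2 < h₀ ∧ h₀ < 2 ∧ ∀ x : (N : ℕ) → (Fin N → EuclideanSpace ℝ (Fin 3)), (∀ N, Literature.MathematicalPhysics.StatisticalMechanics.IsGroundState Literature.MathematicalPhysics.StatisticalMechanics.lennardJones (x N)) → (∀ R ε : ℝ, 0 < R → 0 < ε → ε < 1 / 4 → Filter.Tendsto (fun N : ℕ => (Nat.card {i : Fin N // ¬ (∃ a h : ℝ, 1 / 2 < a ∧ a < 2 ∧ 1 / 2 < h ∧ h < 2 ∧ ∃ z ∈ Literature.MathematicalPhysics.StatisticalMechanics.hcpStacking a h, ∃ A : EuclideanSpace ℝ (Fin 3) →ₗᵢ[ℝ] EuclideanSpace ℝ (Fin 3), (∀ p ∈ Literature.MathematicalPhysics.StatisticalMechanics.hcpStacking a h, dist p z ≤ R → ∃ j : Fin N, dist (x N j) (x N i + A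 (p - z)) ≤ ε) ∧ (∀ j : Fin N, dist (x N j) (x N i) ≤ R → ∃ p ∈ Literature.MathematicalPhysics.StatisticalMechanics.hcpStacking a h, dist (x N j) (x N i + A (p - z)) ≤ ε))} : ℝ) / N) Filter.atTop (nhds 0)) → ∀ R ε δ : ℝ, 0 < R → 0 < ε → ε < 1 / 4 → 0 < δ → Filter.Tendsto (fun N : ℕ => (Nat.card {i : Fin N // (∃ a h : ℝ, 1 / 2 < a ∧ a < 2 ∧ 1 / 2 < h ∧ h < 2 ∧ ∃ z ∈ Literature.MathematicalPhysics.StatisticalMechanics.hcpStacking a h, ∃ A : EuclideanSpace ℝ (Fin 3) →ₗᵢ[ℝ] EuclideanSpace ℝ (Fin 3), (∀ p ∈ Literature.MathematicalPhysics.StatisticalMechanics.hcpStacking a h, dist p z ≤ R → ∃ j : Fin N, dist (x N j) (x N i + A (p - z)) ≤ ε) ∧ (∀ j : Fin N, dist (x N j) (x N i) ≤ R → ∃ p ∈ Literature.MathematicalPhysics.StatisticalMechanics.hcpStacking a h, dist (x N j) (x N i + A (p - z)) ≤ ε)) ∧ ¬ (∃ a h : ℝ, |a - a₀| ≤ δ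 ∧ |h - h₀| ≤ δ ∧ 1 / 2 < a ∧ a < 2 ∧ 1 / 2 < h ∧ h < 2 ∧ ∃ z ∈ Literature.MathematicalPhysics.StatisticalMechanics.hcpStacking a h, ∃ A : EuclideanSpace ℝ (Fin 3) →ₗᵢ[ℝ] EuclideanSpace ℝ (Fin 3), (∀ p ∈ Literature.MathematicalPhysics.StatisticalMechanics.hcpStacking a h, dist p z ≤ R → ∃ j : Fin N, dist (x N j) (x N i + A (p - z)) ≤ ε) ∧ (∀ j : Fin N, dist (x N j) (x N i) ≤ R → ∃ p ∈ Literature.MathematicalPhysics.StatisticalMechanics.hcpStacking a h, dist (x N j) (x N i + A (p - z)) ≤ ε))} : ℝ) / N) Filter.atTop (nhds 0)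

/-- **The glue over the pieces** `LaminarBarlowWindows` (14292), `StackingFaultSparsity`
(14296) and `HcpParameterLock`: they imply the hinge — stated LITERALLY here (definitionally the route
decl), so that the first theorem of this file concluding `LuttingerTiszaRegistry.BulkDefectVanish` BY NAME
is the registered composition `BulkDefectVanish_of` of §8.
Witness `P := hcpPeriodicConfiguration a₀ h₀`; for a target scale `(R, ε)` put `ε₁ = min ε (1/8)`,
`R' = 2R + 1`, `ε' = ε₁ / 2`, `δ = ε₁ / (4 (R + 1))`; then
`{¬P@(R,ε)} ⊆ {¬Barlow@(R',ε')} ∪ {Barlow ∧ ¬hcp @(R',ε')} ∪ {hcp ∧ ¬hcp_δ @(R',ε')}`, the last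
inclusion being the geometric core `template_of_hcpBased`; the three densities vanish by `X₁`, `X₂`
and `X₃` (whose hypothesis — a.e. particle hcp-matched at every scale — is `X₁ ∧ X₂` by the union
bound). [folklore] -/
theorem bulkDefectVanish_of_pieces
    (hX₁ : Summit.AtomisticToContinuum.Crystallization.Theses.LaminarSixThreeThree.LaminarBarlowWindows)
    (hX₂ : Summit.AtomisticToContinuum.Crystallization.Theses.LaminarSixThreeThree.StackingFaultSparsity)
    (hX₃ : HcpParameterLock) :
    ∃ P : Literature.MathematicalPhysics.StatisticalMechanics.PeriodicConfiguration 3, ∀ R ε : ℝ, 0 < R → 0 < ε → ∀ x : (N : ℕ) → (Fin N → EuclideanSpace ℝ (Fin 3)), (∀ N, Literature.MathematicalPhysics.StatisticalMechanics.IsGroundState Literature.MathematicalPhysics.StatisticalMechanics.lennardJones (x N)) → Filter.Tendsto (fun N : ℕ => (Nat.card {i : Fin N // ¬ ∃ A : EuclideanSpace ℝ (Fin 3) →ₗᵢ[ℝ] EuclideanSpace ℝ (Fin 3), (∀ p ∈ P.points, ‖p‖ ≤ R → ∃ j : Fin N, dist (x N j) (x N i + A p) ≤ ε) ∧ (∀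 j : Fin N, dist (x N j) (x N i) ≤ R → ∃ p ∈ P.points, dist (x N j) (x N i + A p) ≤ ε)} : ℝ) / N) Filter.atTop (nhds 0) := by
  obtain ⟨a₀, h₀, ha₀, ha₀2, hh₀, hh₀2, hlock⟩ := hX₃
  have ha₀0 : a₀ ≠ 0 := ne_of_gt (by linarith)
  have hh₀0 : h₀ ≠ 0 := ne_of_gt (by linarith)
  refine ⟨hcpPeriodicConfiguration ha₀0 hh₀0, fun R ε hR hε x hx => ?_⟩
  -- (H) a.e. particle is based-hcp-matched at every scale: `X₁ ∧ X₂` by the union bound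
  have hH : ∀ R ε : ℝ, 0 < R → 0 < ε → ε < 1 / 4 →
      Tendsto (fun N : ℕ => (Nat.card {i : Fin N // ¬ (∃ a h : ℝ, 1 / 2 < a ∧ a < 2 ∧ 1 / 2 < h ∧
        h < 2 ∧ HcpBased a h R ε (x N) i)} : ℝ) / N) atTop (nhds 0) :=
    fun R ε hR hε hε4 => tendsto_density_two_stage _ _ (hX₁ R ε hR hε hε4 x hx) (hX₂ R ε hR hε hε4 x hx)
  -- scales: `ε₁ = min ε (1/8)`, `R' = 2R + 1`, `ε' = ε₁/2`, `δ = ε₁/(4(R + 1))`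
  obtain ⟨ε₁, hε₁, hε₁ε, hε₁8⟩ : ∃ ε₁ : ℝ, 0 < ε₁ ∧ ε₁ ≤ ε ∧ ε₁ ≤ 1 / 8 :=
    ⟨min ε (1 / 8), lt_min hε (by norm_num), min_le_left _ _, min_le_right _ _⟩
  have hR1 : 0 < R + 1 := by linarith
  obtain ⟨δ, hδ, hδR⟩ : ∃ δ : ℝ, 0 < δ ∧ δ * (4 * (R + 1)) = ε₁ :=
    ⟨ε₁ / (4 * (R + 1)), by positivity, div_mul_cancel₀ _ (by positivity)⟩
  have hR' : (0 : ℝ) < 2 * R + 1 := by positivity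
  have hε' : (0 : ℝ) < ε₁ / 2 := by positivity
  have hε'4 : ε₁ / 2 < 1 / 4 := by linarith
  have hδ2 : δ ≤ 1 / 2 := by nlinarith
  have hεf : ε₁ / 2 + 2 * δ * R ≤ ε₁ := by nlinarith
  have hεc : ε₁ / 2 + 2 * δ * (R + ε₁ / 2) ≤ ε₁ := by
    have : δ * (ε₁ / 2) ≤ δ * 1 := mul_le_mul_of_nonneg_left (by linarith) hδ.le
    nlinarith
  -- the three vanishing densities at the certification scale `(R', ε')`
  have h1 := hH (2 * R + 1) (ε₁ / 2) hR' hε' hε'4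
  have h2 := hlock x hx hH (2 * R + 1) (ε₁ / 2) δ hR' hε' hε'4 hδ
  have h3 := tendsto_density_two_stage _ _ h1 h2
  -- comparison with the hinge's bad set through the geometric core
  refine tendsto_density_mono _ _ (fun N i hi => ?_) h3
  obtain ⟨a, h, hda, hdh, ha, ha2, hh, hh2, hM⟩ := hi
  have hT : Template (hcpStacking a₀ h₀) R ε₁ (x N) i :=
    template_of_hcpBased ha hh ha₀ hh₀ hda hdh hδ2 hR.le (by linarith) hεf hεc hM
  obtain ⟨A, hA1, hA2⟩ := hT
  refine ⟨A, fun q hq hqR => ?_, fun j hj => ?_⟩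
  · rw [hcpPeriodicConfiguration_points] at hq
    obtain ⟨j, hj⟩ := hA1 q hq hqR
    exact ⟨j, hj.trans hε₁ε⟩
  · obtain ⟨q, hq, hjq⟩ := hA2 j hj
    exact ⟨q, by rw [hcpPeriodicConfiguration_points]; exact hq, hjq.trans hε₁ε⟩


/-! ## §6b The parameter-lock ACCOUNTING — proved (was stub 5 of rev 1–3 of this line)

Coercivity data `(a₀, h₀, κ)` + the matched site-energy bound + a.e. particle hcp-matched at every scale
⇒ the `δ`-strained matched particles have vanishing density.  Tree inputs: `two_mul_interactionEnergy`,
`LennardJonesMinimalDistance_holds`, `KeplerBoundBulk.siteEnergy_lennardJones_ge` (hard-core floor),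
`ChargedEnergyGapNegative.crysEnergyLimit` and `eStar_le`. -/

section Accounting

open Summit.AtomisticToContinuum.Crystallization.Theorems.ChargedEnergyGapNegative (eStar eStar_le crysEnergyLimit)
open Summit.AtomisticToContinuum.Crystallization.Theorems.KeplerBoundBulk (siteEnergy_lennardJones_ge)

/-- **Matching is monotone in the scale**: a chart at `(Rb, εb)` is a chart at every `(Ra, εa)` with
`Ra ≤ Rb`, `εb ≤ εa`. [folklore] -/
theorem hcpBased_mono {a h Ra Rb εa εb : ℝ} {N : ℕ} {y : Fin N → E3} {i : Fin N}
    (hR : Ra ≤ Rb) (hε : εb ≤ εa) (hM : HcpBased a h Rb εb y i) : HcpBased a h Ra εa y i := by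
  obtain ⟨z, hz, A, hf, hc⟩ := hM
  refine ⟨z, hz, A, fun p hp hpR => ?_, fun j hj => ?_⟩
  · obtain ⟨j, hj⟩ := hf p hp (hpR.trans hR)
    exact ⟨j, hj.trans hε⟩
  · obtain ⟨p, hp, hjp⟩ := hc j (hj.trans hR)
    exact ⟨p, hp, hjp.trans hε⟩

/-- Union bound: if `Bad ⊆ U ∪ S` then `#Bad ≤ #U + #S`. [folklore] -/
theorem natCard_le_add_of_imp {N : ℕ} (Bad U S : Fin N → Prop) (h : ∀ i, Bad i → U i ∨ S i) :
    Nat.card {i : Fin N // Bad i} ≤ Nat.card {i : Fin N // U i} + Nat.card {i : Fin N // S i} := by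
  calc Nat.card {i : Fin N // Bad i} = ({i | Bad i} : Set (Fin N)).ncard := rfl
    _ ≤ ({i | U i} ∪ {i | S i} : Set (Fin N)).ncard := by
        refine Set.ncard_le_ncard (fun i hi => ?_)
        simp only [Set.mem_setOf_eq, Set.mem_union] at hi ⊢
        exact h i hi
    _ ≤ ({i | U i} : Set (Fin N)).ncard + ({i | S i} : Set (Fin N)).ncard := Set.ncard_union_le _ _
    _ = Nat.card {i : Fin N // U i} + Nat.card {i : Fin N // S i} := rfl

/-- **Three-class accounting.** If every `G`-particle has `s i ≥ m`, every `S`-particle (`S ⊆ G`) has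
`s i ≥ m + q` (`q ≥ 0`), and every particle has `s i ≥ −C₀` (`C₀ ≥ 0`), then
`N·m + #S·q − #¬G·(C₀ + |m|) ≤ Σ_i s i`. [folklore] -/
theorem sum_ge_three_class {N : ℕ} (s : Fin N → ℝ) (G S : Fin N → Prop) {m q C₀ : ℝ}
    (hSG : ∀ i, S i → G i)
    (hG : ∀ i, G i → m ≤ s i) (hS : ∀ i, S i → m + q ≤ s i) (hall : ∀ i, -C₀ ≤ s i) :
    (N : ℝ) * m + (Nat.card {i : Fin N // S i} : ℝ) * q -
        (Nat.card {i : Fin N // ¬ G i} : ℝ) * (C₀ + |m|) ≤ ∑ i, s i := by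
  classical
  -- pointwise: s i ≥ m + q·[S i] − (C₀ + |m|)·[¬G i]
  have hpt : ∀ i, m + (if S i then q else 0) - (if G i then 0 else (C₀ + |m|)) ≤ s i := by
    intro i
    by_cases hGi : G i
    · by_cases hSi : S i
      · rw [if_pos hSi, if_pos hGi]; linarith [hS i hSi]
      · rw [if_neg hSi, if_pos hGi]; linarith [hG i hGi]
    · have hSi : ¬ S i := fun h => hGi (hSG i h)
      rw [if_neg hSi, if_neg hGi]
      linarith [hall i, le_abs_self m]
  have hsum := Finset.sum_le_sum fun i (_ : i ∈ Finset.univ) => hpt i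
  have hS' : ∑ i : Fin N, (if S i then q else 0) = (Nat.card {i : Fin N // S i} : ℝ) * q := by
    rw [Finset.sum_ite, Finset.sum_const_zero, add_zero, Finset.sum_const, nsmul_eq_mul,
      Nat.card_eq_fintype_card, Fintype.card_subtype]
  have hG' : ∑ i : Fin N, (if G i then (0 : ℝ) else (C₀ + |m|)) =
      (Nat.card {i : Fin N // ¬ G i} : ℝ) * (C₀ + |m|) := by
    rw [Finset.sum_ite, Finset.sum_const_zero, zero_add, Finset.sum_const, nsmul_eq_mul,
      Nat.card_eq_fintype_card, Fintype.card_subtype]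
  have hm : ∑ _i : Fin N, m = (N : ℝ) * m := by
    rw [Finset.sum_const, Finset.card_univ, Fintype.card_fin, nsmul_eq_mul]
  calc (N : ℝ) * m + (Nat.card {i : Fin N // S i} : ℝ) * q -
        (Nat.card {i : Fin N // ¬ G i} : ℝ) * (C₀ + |m|)
      = ∑ i : Fin N, (m + (if S i then q else 0) - (if G i then 0 else (C₀ + |m|))) := by
        rw [Finset.sum_sub_distrib, Finset.sum_add_distrib, hm, hS', hG']
    _ ≤ ∑ i, s i := hsum

/-- **Finite-`N` count of the strained particles.** With `m`-bounds for particles matched at the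
certification scale `(R₁, ε₁)`, an extra `2κδ²` for those matched at `δ`-strained parameters, the
floor `−C₀`, and `(R', ε')` finer than both `(R, ε)` and `(R₁, ε₁)`:
`#Bad(R,ε,δ) · 2κδ² ≤ Σ_i site_i − N·m + #U(R',ε') · (C₀ + |m| + 2κδ²)`. [folklore] -/
theorem strained_card_bound {N : ℕ} (y : Fin N → E3) {a₀ h₀ κ δ m C₀ R R' R₁ ε ε' ε₁ : ℝ}
    (hκ : 0 < κ) (hδ : 0 < δ)
    (hRR' : R ≤ R') (hR₁R' : R₁ ≤ R') (hε'ε : ε' ≤ ε) (hε'ε₁ : ε' ≤ ε₁)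
    (hG : ∀ (i : Fin N) (a h : ℝ), 1 / 2 < a → a < 2 → 1 / 2 < h → h < 2 →
      HcpBased a h R₁ ε₁ y i → m ≤ siteEnergy lennardJones y i)
    (hS : ∀ (i : Fin N) (a h : ℝ), 1 / 2 < a → a < 2 → 1 / 2 < h → h < 2 →
      HcpBased a h R₁ ε₁ y i → (δ < |a - a₀| ∨ δ < |h - h₀|) →
      m + 2 * κ * δ ^ 2 ≤ siteEnergy lennardJones y i)
    (hfloor : ∀ i, -C₀ ≤ siteEnergy lennardJones y i) :
    (Nat.card {i : Fin N // (∃ a h : ℝ, 1 / 2 < a ∧ a < 2 ∧ 1 / 2 < h ∧ h < 2 ∧ HcpBased a h R ε y i) ∧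
        ¬ (∃ a h : ℝ, |a - a₀| ≤ δ ∧ |h - h₀| ≤ δ ∧ 1 / 2 < a ∧ a < 2 ∧ 1 / 2 < h ∧ h < 2 ∧
          HcpBased a h R ε y i)} : ℝ) * (2 * κ * δ ^ 2) ≤
      (∑ i, siteEnergy lennardJones y i) - N * m +
        (Nat.card {i : Fin N // ¬ ∃ a h : ℝ, 1 / 2 < a ∧ a < 2 ∧ 1 / 2 < h ∧ h < 2 ∧
          HcpBased a h R' ε' y i} : ℝ) * (C₀ + |m| + 2 * κ * δ ^ 2) := by
  have hq : (0 : ℝ) ≤ 2 * κ * δ ^ 2 := by positivity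
  -- the strained particles at the fine scale
  have h3 := sum_ge_three_class (siteEnergy lennardJones y)
    (fun i => ∃ a h : ℝ, 1 / 2 < a ∧ a < 2 ∧ 1 / 2 < h ∧ h < 2 ∧ HcpBased a h R' ε' y i)
    (fun i => ∃ a h : ℝ, (δ < |a - a₀| ∨ δ < |h - h₀|) ∧ 1 / 2 < a ∧ a < 2 ∧ 1 / 2 < h ∧ h < 2 ∧
      HcpBased a h R' ε' y i)
    (fun i ⟨a, h, _, b1, b2, b3, b4, hM⟩ => ⟨a, h, b1, b2, b3, b4, hM⟩)
    (fun i ⟨a, h, b1, b2, b3, b4, hM⟩ => hG i a h b1 b2 b3 b4 (hcpBased_mono hR₁R' hε'ε₁ hM))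
    (fun i ⟨a, h, hd, b1, b2, b3, b4, hM⟩ => hS i a h b1 b2 b3 b4 (hcpBased_mono hR₁R' hε'ε₁ hM) hd)
    hfloor
  -- Bad ⊆ U ∪ S
  have hB := natCard_le_add_of_imp
    (fun i => (∃ a h : ℝ, 1 / 2 < a ∧ a < 2 ∧ 1 / 2 < h ∧ h < 2 ∧ HcpBased a h R ε y i) ∧
        ¬ (∃ a h : ℝ, |a - a₀| ≤ δ ∧ |h - h₀| ≤ δ ∧ 1 / 2 < a ∧ a < 2 ∧ 1 / 2 < h ∧ h < 2 ∧
          HcpBased a h R ε y i))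
    (fun i => ¬ ∃ a h : ℝ, 1 / 2 < a ∧ a < 2 ∧ 1 / 2 < h ∧ h < 2 ∧ HcpBased a h R' ε' y i)
    (fun i => ∃ a h : ℝ, (δ < |a - a₀| ∨ δ < |h - h₀|) ∧ 1 / 2 < a ∧ a < 2 ∧ 1 / 2 < h ∧ h < 2 ∧
      HcpBased a h R' ε' y i)
    (by
      rintro i ⟨-, hnot⟩
      by_cases hU : ∃ a h : ℝ, 1 / 2 < a ∧ a < 2 ∧ 1 / 2 < h ∧ h < 2 ∧ HcpBased a h R' ε' y i
      · obtain ⟨a, h, b1, b2, b3, b4, hM⟩ := hU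
        by_cases hda : |a - a₀| ≤ δ
        · by_cases hdh : |h - h₀| ≤ δ
          · exact absurd ⟨a, h, hda, hdh, b1, b2, b3, b4, hcpBased_mono hRR' hε'ε hM⟩ hnot
          · exact Or.inr ⟨a, h, Or.inr (not_le.1 hdh), b1, b2, b3, b4, hM⟩
        · exact Or.inr ⟨a, h, Or.inl (not_le.1 hda), b1, b2, b3, b4, hM⟩
      · exact Or.inl hU)
  have hB' : (Nat.card {i : Fin N // (∃ a h : ℝ, 1 / 2 < a ∧ a < 2 ∧ 1 / 2 < h ∧ h < 2 ∧
      HcpBased a h R ε y i) ∧ ¬ (∃ a h : ℝ, |a - a₀| ≤ δ ∧ |h - h₀| ≤ δ ∧ 1 / 2 < a ∧ a < 2 ∧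
        1 / 2 < h ∧ h < 2 ∧ HcpBased a h R ε y i)} : ℝ) ≤
      (Nat.card {i : Fin N // ¬ ∃ a h : ℝ, 1 / 2 < a ∧ a < 2 ∧ 1 / 2 < h ∧ h < 2 ∧
          HcpBased a h R' ε' y i} : ℝ) +
        (Nat.card {i : Fin N // ∃ a h : ℝ, (δ < |a - a₀| ∨ δ < |h - h₀|) ∧ 1 / 2 < a ∧ a < 2 ∧
          1 / 2 < h ∧ h < 2 ∧ HcpBased a h R' ε' y i} : ℝ) := by
    exact_mod_cast hB
  nlinarith [hB', h3, hq, mul_le_mul_of_nonneg_right hB' hq]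

/-- **The parameter-lock accounting (stub 5 of line `param_lock`, PROVED).** Given coercivity data
`(a₀, h₀, κ)` of `(a, h) ↦ e(hcp a h)` on the box, the matched site-energy bound (for every `η` some
scale `(R₁, ε₁)` at which a based-hcp-matched ground-state particle has site energy `≥ 2e(hcp a h) − η`)
and a ground-state sequence in which a.e. particle is based-hcp-matched at every scale, for every
`(R, ε, δ)` the particles matched at `(R, ε)` but at no `δ`-close parameters number `o(N)`.
Proof: for a target density `t` put `η = κδ²t/4`, refine to `(R', ε') = (max R R₁, min ε ε₁)`;
`2E(N) = Σ_i site_i ≥ N(2e₀ − η) + #Bad·2κδ² − #U·C` (three classes; matching is monotone in the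
scale, so a `δ`-strained particle at `(R, ε)` is unmatched or strained at `(R', ε')`), while
`2E(N) ≤ N(2e₀ + η)` eventually (`crysEnergyLimit`, `eStar_le`) and `#U = o(N)`; hence
`#Bad/N ≤ t/4 + o(1) < t` eventually. [folklore] -/
theorem parameterLockAccounting : ∀ a₀ h₀ κ : ℝ, ∀ (ha₀ : a₀ ≠ 0) (hh₀ : h₀ ≠ 0), 1 / 2 < a₀ → a₀ < 2 → 1 / 2 < h₀ → h₀ < 2 → 0 < κ → (∀ a h : ℝ, ∀ (ha : a ≠ 0) (hh : h ≠ 0), 1 / 2 < a → a < 2 → 1 / 2 < h → h < 2 → (Literature.MathematicalPhysics.StatisticalMechanics.hcpPeriodicConfiguration ha₀ hh₀).energyPerParticle Literature.MathematicalPhysics.StatisticalMechanics.lennardJones + κ * ((a - a₀) ^ 2 + (h - h₀) ^ 2) ≤ (Literature.MathematicalPhysics.StatisticalMechanics.hcpPeriodicConfiguration ha hh).energyPerParticle Literature.MathematicalPhysics.StatisticalMechanics.lennardJones) → (∀ η : ℝ, 0 < η → ∃ R ε : ℝ, 0 < R ∧ 0 < ε ∧ ε < 1 / 4 ∧ ∀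 (N : ℕ) (x : Fin N → EuclideanSpace ℝ (Fin 3)), Literature.MathematicalPhysics.StatisticalMechanics.IsGroundState Literature.MathematicalPhysics.StatisticalMechanics.lennardJones x → ∀ (i : Fin N) (a h : ℝ) (ha : a ≠ 0) (hh : h ≠ 0), 1 / 2 < a → a < 2 → 1 / 2 < h → h < 2 → (∃ z ∈ Literature.MathematicalPhysics.StatisticalMechanics.hcpStacking a h, ∃ A : EuclideanSpace ℝ (Fin 3) →ₗᵢ[ℝ] EuclideanSpace ℝ (Fin 3), (∀ p ∈ Literature.MathematicalPhysics.StatisticalMechanics.hcpStacking a h, dist p z ≤ R → ∃ j : Fin N, dist (x j) (x i + A (p - z)) ≤ ε) ∧ (∀ j : Fin N, dist (x j) (x i) ≤ R → ∃ p ∈ Literature.MathematicalPhysics.StatisticalMechanics.hcpStacking a h, dist (x j) (x i + A (p - z)) ≤ ε)) → 2 * (Literature.MathematicalPhysics.StatisticalMechanics.hcpPeriodicConfiguration ha hh).energyPerParticle Literature.MathematicalPhysics.StatisticalMechanics.lennardJones - η ≤ ∑ j ∈ Finset.univ.erase i, Literature.MathematicalPhysics.StatisticalMechanics.lennardJones (dist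 (x i) (x j))) → ∀ x : (N : ℕ) → (Fin N → EuclideanSpace ℝ (Fin 3)), (∀ N, Literature.MathematicalPhysics.StatisticalMechanics.IsGroundState Literature.MathematicalPhysics.StatisticalMechanics.lennardJones (x N)) → (∀ R ε : ℝ, 0 < R → 0 < ε → ε < 1 / 4 → Filter.Tendsto (fun N : ℕ => (Nat.card {i : Fin N // ¬ (∃ a h : ℝ, 1 / 2 < a ∧ a < 2 ∧ 1 / 2 < h ∧ h < 2 ∧ ∃ z ∈ Literature.MathematicalPhysics.StatisticalMechanics.hcpStacking a h, ∃ A : EuclideanSpace ℝ (Fin 3) →ₗᵢ[ℝ] EuclideanSpace ℝ (Fin 3), (∀ p ∈ Literature.MathematicalPhysics.StatisticalMechanics.hcpStacking a h, dist p z ≤ R → ∃ j : Fin N, dist (x N j) (x N i + A (p - z)) ≤ ε) ∧ (∀ j : Fin N, dist (x N j) (x N i) ≤ R → ∃ p ∈ Literature.MathematicalPhysics.StatisticalMechanics.hcpStacking a h, dist (x N j) (x N i + A (p - z)) ≤ ε))} : ℝ) / N) Filter.atTop (nhds 0)) → ∀ R ε δ : ℝ, 0 < R → 0 < ε → ε <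 1 / 4 → 0 < δ → Filter.Tendsto (fun N : ℕ => (Nat.card {i : Fin N // (∃ a h : ℝ, 1 / 2 < a ∧ a < 2 ∧ 1 / 2 < h ∧ h < 2 ∧ ∃ z ∈ Literature.MathematicalPhysics.StatisticalMechanics.hcpStacking a h, ∃ A : EuclideanSpace ℝ (Fin 3) →ₗᵢ[ℝ] EuclideanSpace ℝ (Fin 3), (∀ p ∈ Literature.MathematicalPhysics.StatisticalMechanics.hcpStacking a h, dist p z ≤ R → ∃ j : Fin N, dist (x N j) (x N i + A (p - z)) ≤ ε) ∧ (∀ j : Fin N, dist (x N j) (x N i) ≤ R → ∃ p ∈ Literature.MathematicalPhysics.StatisticalMechanics.hcpStacking a h, dist (x N j) (x N i + A (p - z)) ≤ ε)) ∧ ¬ (∃ a h : ℝ, |a - a₀| ≤ δ ∧ |h - h₀| ≤ δ ∧ 1 / 2 < a ∧ a < 2 ∧ 1 / 2 < h ∧ h < 2 ∧ ∃ z ∈ Literature.MathematicalPhysics.StatisticalMechanics.hcpStacking a h, ∃ A : EuclideanSpace ℝ (Fin 3) →ₗᵢ[ℝ] EuclideanSpace ℝ (Fin 3), (∀ p ∈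 Literature.MathematicalPhysics.StatisticalMechanics.hcpStacking a h, dist p z ≤ R → ∃ j : Fin N, dist (x N j) (x N i + A (p - z)) ≤ ε) ∧ (∀ j : Fin N, dist (x N j) (x N i) ≤ R → ∃ p ∈ Literature.MathematicalPhysics.StatisticalMechanics.hcpStacking a h, dist (x N j) (x N i + A (p - z)) ≤ ε))} : ℝ) / N) Filter.atTop (nhds 0) := by
  intro a₀ h₀ κ ha₀ hh₀ b1₀ b2₀ b3₀ b4₀ hκ hco hS2 x hx hH R ε δ hR hε hε4 hδ
  -- the floor from the ground-state hard core
  obtain ⟨δ₀, hδ₀, hsep⟩ := LennardJonesMinimalDistance_holds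
  have hfloor : ∀ (N : ℕ) (i : Fin N), -(1 / 6 * (250 * δ₀⁻¹ ^ 6)) ≤ siteEnergy lennardJones (x N) i :=
    fun N i => siteEnergy_lennardJones_ge (x N) hδ₀ (fun k l hkl => hsep N (x N) (hx N) k l hkl) i
  have hC₀ : (0 : ℝ) ≤ 1 / 6 * (250 * δ₀⁻¹ ^ 6) := by positivity
  -- e₀ and the energy limit
  have he₀ : (⨅ Q : PeriodicConfiguration 3, Q.energyPerParticle lennardJones) ≤
      (hcpPeriodicConfiguration ha₀ hh₀).energyPerParticle lennardJones := eStar_le _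
  -- ε-management
  rw [Metric.tendsto_atTop]
  intro t ht
  obtain ⟨R₁, ε₁, hR₁, hε₁, hε₁4, hsite⟩ := hS2 (κ * δ ^ 2 * t / 4) (by positivity)
  have hR' : 0 < max R R₁ := lt_max_of_lt_left hR
  have hε' : 0 < min ε ε₁ := lt_min hε hε₁
  have hε'4 : min ε ε₁ < 1 / 4 := (min_le_left _ _).trans_lt hε4
  -- the two bounds for matched particles at the certification scale (R₁, ε₁)
  have hGb : ∀ (N : ℕ) (i : Fin N) (a h : ℝ), 1 / 2 < a → a < 2 → 1 / 2 < h → h < 2 →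
      HcpBased a h R₁ ε₁ (x N) i →
      2 * (hcpPeriodicConfiguration ha₀ hh₀).energyPerParticle lennardJones - κ * δ ^ 2 * t / 4 ≤
        siteEnergy lennardJones (x N) i := by
    intro N i a h b1 b2 b3 b4 hM
    have ha : a ≠ 0 := ne_of_gt (by linarith)
    have hh : h ≠ 0 := ne_of_gt (by linarith)
    have h1 := hsite N (x N) (hx N) i a h ha hh b1 b2 b3 b4 hM
    have h2 := hco a h ha hh b1 b2 b3 b4
    have h3 : 0 ≤ κ * ((a - a₀) ^ 2 + (h - h₀) ^ 2) := by positivity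
    unfold siteEnergy
    linarith
  have hSb : ∀ (N : ℕ) (i : Fin N) (a h : ℝ), 1 / 2 < a → a < 2 → 1 / 2 < h → h < 2 →
      HcpBased a h R₁ ε₁ (x N) i → (δ < |a - a₀| ∨ δ < |h - h₀|) →
      2 * (hcpPeriodicConfiguration ha₀ hh₀).energyPerParticle lennardJones - κ * δ ^ 2 * t / 4 +
          2 * κ * δ ^ 2 ≤ siteEnergy lennardJones (x N) i := by
    intro N i a h b1 b2 b3 b4 hM hd
    have ha : a ≠ 0 := ne_of_gt (by linarith)
    have hh : h ≠ 0 := ne_of_gt (by linarith)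
    have h1 := hsite N (x N) (hx N) i a h ha hh b1 b2 b3 b4 hM
    have h2 := hco a h ha hh b1 b2 b3 b4
    have h3 : δ ^ 2 ≤ (a - a₀) ^ 2 + (h - h₀) ^ 2 := by
      rcases hd with hd | hd
      · have := pow_le_pow_left₀ hδ.le hd.le 2
        rw [sq_abs] at this
        nlinarith [sq_nonneg (h - h₀)]
      · have := pow_le_pow_left₀ hδ.le hd.le 2
        rw [sq_abs] at this
        nlinarith [sq_nonneg (a - a₀)]
    have h4 : κ * δ ^ 2 ≤ κ * ((a - a₀) ^ 2 + (h - h₀) ^ 2) := mul_le_mul_of_nonneg_left h3 hκ.le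
    unfold siteEnergy
    linarith
  -- eventually: the unmatched density is small, E(N)/N is close to its limit, N ≥ 1
  set m : ℝ := 2 * (hcpPeriodicConfiguration ha₀ hh₀).energyPerParticle lennardJones -
    κ * δ ^ 2 * t / 4 with hm
  set K : ℝ := (1 / 6 * (250 * δ₀⁻¹ ^ 6) + |m| + 2 * κ * δ ^ 2) / (2 * κ * δ ^ 2) with hK
  have hK0 : 0 ≤ K := by positivity
  have hU := hH (max R R₁) (min ε ε₁) hR' hε' hε'4
  have hev1 : ∀ᶠ N : ℕ in atTop, (Nat.card {i : Fin N // ¬ (∃ a h : ℝ, 1 / 2 < a ∧ a < 2 ∧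
      1 / 2 < h ∧ h < 2 ∧ HcpBased a h (max R R₁) (min ε ε₁) (x N) i)} : ℝ) / N * K < t / 4 := by
    have h0 := hU.mul_const K
    rw [zero_mul] at h0
    exact h0.eventually (eventually_lt_nhds (by positivity))
  have hev2 : ∀ᶠ N : ℕ in atTop, groundStateEnergy lennardJones 3 N / N <
      (hcpPeriodicConfiguration ha₀ hh₀).energyPerParticle lennardJones + κ * δ ^ 2 * t / 8 :=
    crysEnergyLimit.eventually (eventually_lt_nhds (by linarith [he₀, (by positivity : 0 < κ * δ ^ 2 * t / 8)]))
  obtain ⟨N₀, hN₀⟩ := Filter.eventually_atTop.1 (hev1.and (hev2.and (eventually_ge_atTop 1)))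
  refine ⟨N₀, fun N hN => ?_⟩
  obtain ⟨h1, h2, h3⟩ := hN₀ N hN
  have hNpos : (0 : ℝ) < N := by exact_mod_cast h3
  rw [Real.dist_eq, sub_zero, abs_of_nonneg (by positivity)]
  -- the finite-N accounting
  have hacc := strained_card_bound (x N) (a₀ := a₀) (h₀ := h₀) (R := R) (ε := ε) (δ := δ)
    hκ hδ (le_max_left R R₁) (le_max_right R R₁) (min_le_left ε ε₁) (min_le_right ε ε₁)
    (hGb N) (hSb N) (hfloor N)
  -- total energy: Σ site = 2 E(N) < N (2e₀ + κδ²t/4)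
  have hsum : ∑ i, siteEnergy lennardJones (x N) i = 2 * groundStateEnergy lennardJones 3 N := by
    rw [← two_mul_interactionEnergy, (hx N).2]
  have hE : groundStateEnergy lennardJones 3 N <
      N * ((hcpPeriodicConfiguration ha₀ hh₀).energyPerParticle lennardJones + κ * δ ^ 2 * t / 8) := by
    rwa [div_lt_iff₀ hNpos, mul_comm] at h2
  -- unmatched count bound: #U · K < N t / 4
  have hUK : (Nat.card {i : Fin N // ¬ (∃ a h : ℝ, 1 / 2 < a ∧ a < 2 ∧ 1 / 2 < h ∧ h < 2 ∧
      HcpBased a h (max R R₁) (min ε ε₁) (x N) i)} : ℝ) * K < N * (t / 4) := by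
    have := h1
    rw [div_mul_eq_mul_div, div_lt_iff₀ hNpos] at this
    linarith
  have hq : (0 : ℝ) < 2 * κ * δ ^ 2 := by positivity
  have hKq : (1 / 6 * (250 * δ₀⁻¹ ^ 6) + |m| + 2 * κ * δ ^ 2) = K * (2 * κ * δ ^ 2) := by
    rw [hK, div_mul_cancel₀ _ (ne_of_gt hq)]
  rw [div_lt_iff₀ hNpos]
  change (Nat.card {i : Fin N // (∃ a h : ℝ, 1 / 2 < a ∧ a < 2 ∧ 1 / 2 < h ∧ h < 2 ∧
      HcpBased a h R ε (x N) i) ∧ ¬ (∃ a h : ℝ, |a - a₀| ≤ δ ∧ |h - h₀| ≤ δ ∧ 1 / 2 < a ∧ a < 2 ∧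
        1 / 2 < h ∧ h < 2 ∧ HcpBased a h R ε (x N) i)} : ℝ) < t * N
  -- combine
  rw [hsum, hKq] at hacc
  have hU0 : (0 : ℝ) ≤ (Nat.card {i : Fin N // ¬ (∃ a h : ℝ, 1 / 2 < a ∧ a < 2 ∧ 1 / 2 < h ∧ h < 2 ∧
      HcpBased a h (max R R₁) (min ε ε₁) (x N) i)} : ℝ) := by positivity
  have hUKq := mul_lt_mul_of_pos_right hUK hq
  have hpos : (0 : ℝ) ≤ N * t * κ * δ ^ 2 := by positivity
  have key : (Nat.card {i : Fin N // (∃ a h : ℝ, 1 / 2 < a ∧ a < 2 ∧ 1 / 2 < h ∧ h < 2 ∧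
      HcpBased a h R ε (x N) i) ∧ ¬ (∃ a h : ℝ, |a - a₀| ≤ δ ∧ |h - h₀| ≤ δ ∧ 1 / 2 < a ∧ a < 2 ∧
        1 / 2 < h ∧ h < 2 ∧ HcpBased a h R ε (x N) i)} : ℝ) * (2 * κ * δ ^ 2) <
      t * N * (2 * κ * δ ^ 2) := by
    nlinarith [hacc, hE, hUKq, hpos, hU0]
  exact lt_of_mul_lt_mul_right key hq.le

end Accounting

/-! ## §7 The stubs of line `param-lock` -/

/-- **Stub 1 — LAYERING** (= item stmt-AtomisticToContinuum-14292 `LaminarSixThreeThree.LaminarBarlowWindows`,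
verbatim): a.e. particle of a large LJ ground state has its `R`-window two-way `ε`-matched (based at a site,
linear chart) to SOME Barlow stacking with `a, h ∈ (1/2, 2)`. Size XL (open physics). -/
theorem stub_laminarBarlowWindows : ∀ R ε : ℝ, 0 < R → 0 < ε → ε < 1 / 4 → ∀ x : (N : ℕ) → (Fin N → EuclideanSpace ℝ (Fin 3)), (∀ N, Literature.MathematicalPhysics.StatisticalMechanics.IsGroundState Literature.MathematicalPhysics.StatisticalMechanics.lennardJones (x N)) → Filter.Tendsto (fun N : ℕ => (Nat.card {i : Fin N // ¬ (∃ a h : ℝ, 1 / 2 < a ∧ a < 2 ∧ 1 / 2 < h ∧ h < 2 ∧ ∃ s : ℤ → ℤ, Literature.MathematicalPhysics.StatisticalMechanics.IsHaggSeq s ∧ ∃ z ∈ Literature.MathematicalPhysics.StatisticalMechanics.barlowStacking a h s, ∃ A : EuclideanSpace ℝ (Fin 3) →ₗᵢ[ℝ] EuclideanSpace ℝ (Fin 3), (∀ p ∈ Literature.MathematicalPhysics.StatisticalMechanics.barlowStacking a h s, dist p z ≤ R → ∃ j : Fin N, dist (x N j) (x N i + A (p - z)) ≤ ε) ∧ (∀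 j : Fin N, dist (x N j) (x N i) ≤ R → ∃ p ∈ Literature.MathematicalPhysics.StatisticalMechanics.barlowStacking a h s, dist (x N j) (x N i + A (p - z)) ≤ ε))} : ℝ) / N) Filter.atTop (nhds 0) := by
  sorry

/-- **Stub 2 — STACKING SELECTION** (= item stmt-AtomisticToContinuum-14296
`LaminarSixThreeThree.StackingFaultSparsity`, verbatim): a.e. Barlow-matched particle is hcp-matched. In route
`LuttingerTiszaRegistry` the price per fault is the COUNTED one of `LjFaultCountedSelection` (`|J₂|/2` per cubic
letter) against the `O(N^(2/3))` surface budget. Size XL. -/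
theorem stub_stackingFaultSparsity : ∀ R ε : ℝ, 0 < R → 0 < ε → ε < 1 / 4 → ∀ x : (N : ℕ) → (Fin N → EuclideanSpace ℝ (Fin 3)), (∀ N, Literature.MathematicalPhysics.StatisticalMechanics.IsGroundState Literature.MathematicalPhysics.StatisticalMechanics.lennardJones (x N)) → Filter.Tendsto (fun N : ℕ => (Nat.card {i : Fin N // (∃ a h : ℝ, 1 / 2 < a ∧ a < 2 ∧ 1 / 2 < h ∧ h < 2 ∧ ∃ s : ℤ → ℤ, Literature.MathematicalPhysics.StatisticalMechanics.IsHaggSeq s ∧ ∃ z ∈ Literature.MathematicalPhysics.StatisticalMechanics.barlowStacking a h s, ∃ A : EuclideanSpace ℝ (Fin 3) →ₗᵢ[ℝ] EuclideanSpace ℝ (Fin 3), (∀ p ∈ Literature.MathematicalPhysics.StatisticalMechanics.barlowStacking a h s, dist p z ≤ R → ∃ j : Fin N, dist (x N j) (x N i + A (p - z)) ≤ ε) ∧ (∀ j : Fin N, dist (x N j) (x N i) ≤ R → ∃ p ∈ Literature.MathematicalPhysics.StatisticalMechanics.barlowStacking a h s, dist (x N j) (x N i + A (p - z)) ≤ ε))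 ∧ ¬ (∃ a h : ℝ, 1 / 2 < a ∧ a < 2 ∧ 1 / 2 < h ∧ h < 2 ∧ ∃ z ∈ Literature.MathematicalPhysics.StatisticalMechanics.hcpStacking a h, ∃ A : EuclideanSpace ℝ (Fin 3) →ₗᵢ[ℝ] EuclideanSpace ℝ (Fin 3), (∀ p ∈ Literature.MathematicalPhysics.StatisticalMechanics.hcpStacking a h, dist p z ≤ R → ∃ j : Fin N, dist (x N j) (x N i + A (p - z)) ≤ ε) ∧ (∀ j : Fin N, dist (x N j) (x N i) ≤ R → ∃ p ∈ Literature.MathematicalPhysics.StatisticalMechanics.hcpStacking a h, dist (x N j) (x N i + A (p - z)) ≤ ε))} : ℝ) / N) Filter.atTop (nhds 0) := by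
  sorry

/-- **Stub 3 — COERCIVITY of the relaxed-hcp energy in the lattice parameters** (numerics-grade): there are ONE
pair `(a₀, h₀) ∈ (1/2, 2)²` and `κ > 0` with `e(hcp a₀ h₀) + κ((a − a₀)² + (h − h₀)²) ≤ e(hcp a h)` for all
`(a, h)` in the box (expected `(a₀, h₀) ≈ (0.9712, 0.7930)`, Stillinger 2001; certified interval lattice sums
of Burrows et al. 2020 / Schwerdtfeger–Burrows–Smits 2021 near the minimum, crude monotone bounds far from it).
Fails iff the minimiser is degenerate or non-unique on the box. Size L. -/
theorem stub_hcpEnergyCoercive : ∃ a₀ h₀ κ : ℝ, ∃ (ha₀ : a₀ ≠ 0) (hh₀ : h₀ ≠ 0), 1 / 2 < a₀ ∧ a₀ < 2 ∧ 1 / 2 < h₀ ∧ h₀ < 2 ∧ 0 < κ ∧ ∀ a h : ℝ, ∀ (ha : a ≠ 0) (hh : h ≠ 0), 1 / 2 < a → a < 2 → 1 / 2 < h → h < 2 → (Literature.MathematicalPhysics.StatisticalMechanics.hcpPeriodicConfiguration ha₀ hh₀).energyPerParticle Literature.MathematicalPhysics.StatisticalMechanics.lennardJones + κ * ((a - a₀)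 ^ 2 + (h - h₀) ^ 2) ≤ (Literature.MathematicalPhysics.StatisticalMechanics.hcpPeriodicConfiguration ha hh).energyPerParticle Literature.MathematicalPhysics.StatisticalMechanics.lennardJones := by
  sorry

/-- **Stub 4 — SITE ENERGY OF AN hcp-MATCHED PARTICLE** (analysis, M): for every `η > 0` there is a scale
`(R, ε)` such that a particle of a Lennard-Jones ground state based-hcp-matched at `(R, ε)` with parameters
`(a, h) ∈ (1/2, 2)²` has site energy `Σ_(j ≠ i) V(|x_i − x_j|) ≥ 2 e(hcp a h) − η` (two-way matching is an
injection above the ground-state hard core `LennardJonesMinimalDistance_holds`; truncation of the absolutely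
convergent lattice sum `2e = Σ_(q ≠ 0) V(|q|)` whose far part is negative; modulus of continuity of `V_LJ` on
`[δ₀, R + 1]`; far particles `≥ −(250/6) δ₀⁻⁵ (R − 1)⁻¹`; all uniform on the box — cf. the landed
`KeplerBoundBulk.siteEnergy_ge_of_matchedAt`, `siteSum_le_sum_near`). -/
theorem stub_hcpMatchedSiteEnergy : ∀ η : ℝ, 0 < η → ∃ R ε : ℝ, 0 < R ∧ 0 < ε ∧ ε < 1 / 4 ∧ ∀ (N : ℕ) (x : Fin N → EuclideanSpace ℝ (Fin 3)), Literature.MathematicalPhysics.StatisticalMechanics.IsGroundState Literature.MathematicalPhysics.StatisticalMechanics.lennardJones x → ∀ (i : Fin N) (a h : ℝ) (ha : a ≠ 0) (hh : h ≠ 0), 1 / 2 < a → a < 2 → 1 / 2 < h → h < 2 → (∃ z ∈ Literature.MathematicalPhysics.StatisticalMechanics.hcpStacking a h, ∃ A : EuclideanSpace ℝ (Fin 3) →ₗᵢ[ℝ] EuclideanSpace ℝ (Fin 3), (∀ p ∈ Literature.MathematicalPhysics.StatisticalMechanics.hcpStacking a h, dist p z ≤ R → ∃ j : Fin N, dist (x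 j) (x i + A (p - z)) ≤ ε) ∧ (∀ j : Fin N, dist (x j) (x i) ≤ R → ∃ p ∈ Literature.MathematicalPhysics.StatisticalMechanics.hcpStacking a h, dist (x j) (x i + A (p - z)) ≤ ε)) → 2 * (Literature.MathematicalPhysics.StatisticalMechanics.hcpPeriodicConfiguration ha hh).energyPerParticle Literature.MathematicalPhysics.StatisticalMechanics.lennardJones - η ≤ ∑ j ∈ Finset.univ.erase i, Literature.MathematicalPhysics.StatisticalMechanics.lennardJones (dist (x i) (x j)) := by
  sorry

/-! ## §8 The compositions (kernel-checked, no sorry) -/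

/-! ### Named statements of the two new stubs (so that the compositions take their hypotheses BY NAME:
the `#h21_check_skeleton` audit admits as hypotheses only tagged decls — items 14292/14296 — and constants
whose short name is a declared stub). Each is, verbatim, the signature of the corresponding `stub_*`. -/
namespace Stmt

/-- Statement of `stub_hcpEnergyCoercive` (verbatim). -/
def stub_hcpEnergyCoercive : Prop :=
  ∃ a₀ h₀ κ : ℝ, ∃ (ha₀ : a₀ ≠ 0) (hh₀ : h₀ ≠ 0), 1 / 2 < a₀ ∧ a₀ < 2 ∧ 1 / 2 < h₀ ∧ h₀ < 2 ∧ 0 < κ ∧ ∀ a h : ℝ, ∀ (ha : a ≠ 0) (hh : h ≠ 0), 1 / 2 < a → a < 2 → 1 / 2 < h → h < 2 → (Literature.MathematicalPhysics.StatisticalMechanics.hcpPeriodicConfiguration ha₀ hh₀).energyPerParticle Literature.MathematicalPhysics.StatisticalMechanics.lennardJones + κ * ((a - a₀) ^ 2 + (h - h₀) ^ 2) ≤ (Literature.MathematicalPhysics.StatisticalMechanics.hcpPeriodicConfiguration ha hh).energyPerParticle Literature.MathematicalPhysics.StatisticalMechanics.lennardJones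

/-- Statement of `stub_hcpMatchedSiteEnergy` (verbatim). -/
def stub_hcpMatchedSiteEnergy : Prop :=
  ∀ η : ℝ, 0 < η → ∃ R ε : ℝ, 0 < R ∧ 0 < ε ∧ ε < 1 / 4 ∧ ∀ (N : ℕ) (x : Fin N → EuclideanSpace ℝ (Fin 3)), Literature.MathematicalPhysics.StatisticalMechanics.IsGroundState Literature.MathematicalPhysics.StatisticalMechanics.lennardJones x → ∀ (i : Fin N) (a h : ℝ) (ha : a ≠ 0) (hh : h ≠ 0), 1 / 2 < a → a < 2 → 1 / 2 < h → h < 2 → (∃ z ∈ Literature.MathematicalPhysics.StatisticalMechanics.hcpStacking a h, ∃ A : EuclideanSpace ℝ (Fin 3) →ₗᵢ[ℝ] EuclideanSpace ℝ (Fin 3), (∀ p ∈ Literature.MathematicalPhysics.StatisticalMechanics.hcpStacking a h, dist p z ≤ R → ∃ j : Fin N, dist (x j) (x i + A (p - z)) ≤ ε) ∧ (∀ j : Fin N, dist (x j) (x i) ≤ R → ∃ p ∈ Literature.MathematicalPhysics.StatisticalMechanics.hcpStacking a h, dist (x j) (x i + A (p - z)) ≤ ε)) → 2 * (Literature.MathematicalPhysics.StatisticalMechanics.hcpPeriodicConfiguration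 ha hh).energyPerParticle Literature.MathematicalPhysics.StatisticalMechanics.lennardJones - η ≤ ∑ j ∈ Finset.univ.erase i, Literature.MathematicalPhysics.StatisticalMechanics.lennardJones (dist (x i) (x j))

end Stmt

/-- The two new stubs prove their named statements (definitional unfolding). -/
example : Stmt.stub_hcpEnergyCoercive ∧ Stmt.stub_hcpMatchedSiteEnergy :=
  ⟨stub_hcpEnergyCoercive, stub_hcpMatchedSiteEnergy⟩

/-- **The new piece from stubs 3–4 and the PROVED accounting**: `HcpParameterLock` (§6). -/
theorem HcpParameterLock_of (h₃ : Stmt.stub_hcpEnergyCoercive) (h₄ : Stmt.stub_hcpMatchedSiteEnergy) :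
    HcpParameterLock := by
  obtain ⟨a₀, h₀, κ, ha₀, hh₀, b1, b2, b3, b4, hκ, hco⟩ := h₃
  exact ⟨a₀, h₀, b1, b2, b3, b4, fun x hx hH =>
    parameterLockAccounting a₀ h₀ κ ha₀ hh₀ b1 b2 b3 b4 hκ hco h₄ x hx hH⟩

/-- **Composition** — items 14292, 14296 (by name) and stubs 3–4 (by their named statements) imply the
crux `LuttingerTiszaRegistry.BulkDefectVanish` BY NAME: the proved glue `bulkDefectVanish_of_pieces`
applied to `h₁`, `h₂` and `HcpParameterLock_of h₃ h₄` (which runs the proved accounting). -/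
theorem BulkDefectVanish_of (h₁ : Summit.AtomisticToContinuum.Crystallization.Theses.LaminarSixThreeThree.LaminarBarlowWindows)
    (h₂ : Summit.AtomisticToContinuum.Crystallization.Theses.LaminarSixThreeThree.StackingFaultSparsity)
    (h₃ : Stmt.stub_hcpEnergyCoercive) (h₄ : Stmt.stub_hcpMatchedSiteEnergy) :
    Summit.AtomisticToContinuum.Crystallization.Theses.LuttingerTiszaRegistry.BulkDefectVanish :=
  bulkDefectVanish_of_pieces h₁ h₂ (HcpParameterLock_of h₃ h₄)

/-- The crux by name, modulo the four stubs (the only `sorry`s in its cone are the four `stub_*`). -/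
theorem BulkDefectVanish_skeleton : Summit.AtomisticToContinuum.Crystallization.Theses.LuttingerTiszaRegistry.BulkDefectVanish :=
  BulkDefectVanish_of stub_laminarBarlowWindows stub_stackingFaultSparsity stub_hcpEnergyCoercive
    stub_hcpMatchedSiteEnergy

/-! ### The shared copies of the crux (identical signatures; definitional unfolding) -/

/-- `PoissonBesselStacking` copy. -/
theorem BulkDefectVanish_ofPBS (h₁ : Summit.AtomisticToContinuum.Crystallization.Theses.LaminarSixThreeThree.LaminarBarlowWindows)
    (h₂ : Summit.AtomisticToContinuum.Crystallization.Theses.LaminarSixThreeThree.StackingFaultSparsity)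
    (h₃ : Stmt.stub_hcpEnergyCoercive) (h₄ : Stmt.stub_hcpMatchedSiteEnergy) :
    Summit.AtomisticToContinuum.Crystallization.Theses.PoissonBesselStacking.BulkDefectVanish :=
  bulkDefectVanish_of_pieces h₁ h₂ (HcpParameterLock_of h₃ h₄)

/-- `ThreeConeCertificate` copy. -/
theorem BulkDefectVanish_ofTCC (h₁ : Summit.AtomisticToContinuum.Crystallization.Theses.LaminarSixThreeThree.LaminarBarlowWindows)
    (h₂ : Summit.AtomisticToContinuum.Crystallization.Theses.LaminarSixThreeThree.StackingFaultSparsity)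
    (h₃ : Stmt.stub_hcpEnergyCoercive) (h₄ : Stmt.stub_hcpMatchedSiteEnergy) :
    Summit.AtomisticToContinuum.Crystallization.Theses.ThreeConeCertificate.BulkDefectVanish :=
  bulkDefectVanish_of_pieces h₁ h₂ (HcpParameterLock_of h₃ h₄)

/-- `FrustrationRangeCertificates` copy. -/
theorem BulkDefectVanish_ofFRC (h₁ : Summit.AtomisticToContinuum.Crystallization.Theses.LaminarSixThreeThree.LaminarBarlowWindows)
    (h₂ : Summit.AtomisticToContinuum.Crystallization.Theses.LaminarSixThreeThree.StackingFaultSparsity)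
    (h₃ : Stmt.stub_hcpEnergyCoercive) (h₄ : Stmt.stub_hcpMatchedSiteEnergy) :
    Summit.AtomisticToContinuum.Crystallization.Theses.FrustrationRangeCertificates.BulkDefectVanish :=
  bulkDefectVanish_of_pieces h₁ h₂ (HcpParameterLock_of h₃ h₄)

/-- `CrystalKissingRigidity` copy (retired route; still the item's default decl for `ledger skeleton check`). -/
theorem BulkDefectVanish_ofCKR (h₁ : Summit.AtomisticToContinuum.Crystallization.Theses.LaminarSixThreeThree.LaminarBarlowWindows)
    (h₂ : Summit.AtomisticToContinuum.Crystallization.Theses.LaminarSixThreeThree.StackingFaultSparsity)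
    (h₃ : Stmt.stub_hcpEnergyCoercive) (h₄ : Stmt.stub_hcpMatchedSiteEnergy) :
    Summit.AtomisticToContinuum.Crystallization.Theses.CrystalKissingRigidity.BulkDefectVanish :=
  bulkDefectVanish_of_pieces h₁ h₂ (HcpParameterLock_of h₃ h₄)

theorem BulkDefectVanish_skeletonPBS : Summit.AtomisticToContinuum.Crystallization.Theses.PoissonBesselStacking.BulkDefectVanish :=
  BulkDefectVanish_ofPBS stub_laminarBarlowWindows stub_stackingFaultSparsity stub_hcpEnergyCoercive
    stub_hcpMatchedSiteEnergy

theorem BulkDefectVanish_skeletonTCC : Summit.AtomisticToContinuum.Crystallization.Theses.ThreeConeCertificate.BulkDefectVanish :=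
  BulkDefectVanish_ofTCC stub_laminarBarlowWindows stub_stackingFaultSparsity stub_hcpEnergyCoercive
    stub_hcpMatchedSiteEnergy

theorem BulkDefectVanish_skeletonFRC : Summit.AtomisticToContinuum.Crystallization.Theses.FrustrationRangeCertificates.BulkDefectVanish :=
  BulkDefectVanish_ofFRC stub_laminarBarlowWindows stub_stackingFaultSparsity stub_hcpEnergyCoercive
    stub_hcpMatchedSiteEnergy

/-- The item's default decl (CrystalKissingRigidity copy), modulo the four stubs. -/
theorem BulkDefectVanish_proof : Summit.AtomisticToContinuum.Crystallization.Theses.CrystalKissingRigidity.BulkDefectVanish :=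
  BulkDefectVanish_ofCKR stub_laminarBarlowWindows stub_stackingFaultSparsity stub_hcpEnergyCoercive
    stub_hcpMatchedSiteEnergy

/-- By-name reading of stubs 1–2: definitionally items 14292 and 14296. -/
example : Summit.AtomisticToContinuum.Crystallization.Theses.LaminarSixThreeThree.LaminarBarlowWindows ∧
    Summit.AtomisticToContinuum.Crystallization.Theses.LaminarSixThreeThree.StackingFaultSparsity :=
  ⟨stub_laminarBarlowWindows, stub_stackingFaultSparsity⟩

end Summit.AtomisticToContinuum.Crystallization.Cruxes.BulkDefectVanish.ParamLock

end
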